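import Literature.Analysis.FluidPDE.TaoCascadeRescaled
import Literature.Analysis.ODE.LinearComparison
import Literature.Analysis.ODE.MaximalTime
import Literature.Analysis.FluidPDE.TaoCascadeRescaledBootstrap
import Literature.Analysis.FluidPDE.TaoCascadeZeroScale
import Literature.Analysis.FluidPDE.TaoCascadeFiveModes
import Mathlib.Analysis.SpecialFunctions.Pow.Real
import Mathlib.Analysis.SpecialFunctions.Sqrt
import Mathlib.Analysis.SpecialFunctions.ExpDeriv
import Mathlib.Analysis.Complex.ExponentialBounds
import HarnessLib

/-!
# Tao's cascade ODE, §6.7 (dynamics at the zero scale): the setting of the bootstrap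

T. Tao, *Finite time blowup for an averaged three-dimensional Navier–Stokes equation*,
J. Amer. Math. Soc. 29 (2016), 601–674 = arXiv:1402.0290v3, §6.5–§6.7 (display numbers of
arXiv v3, as in the sibling `TaoCascade*` files; authoritative locators are the lemma /
proposition numbers).

The proof of Prop. 6.15 ("reduced induction claim, II", §6.7) — the last link of the chain
Thm. 6.2 ⇐ Prop. 6.3 ⇐ Prop. 6.4 ⇐ Prop. 6.5 ⇐ Prop. 6.12 ⇐ Prop. 6.15 — works inside the
following standing hypotheses, which this file packages once and for all (so that the assembly
of §6.7 can be stated as a closed theorem whose inputs are exactly the outputs of §6.5–§6.6):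

* the landed `RescaledHypotheses` (hypotheses (i)–(ix) of Prop. 6.5, `TaoCascadeRescaled.lean`)
  with the corrected `c`-coefficient `10⁻⁵ exp(-K¹⁰/2)`, parameter signs, `n₀ ≤ N`, and a time
  `0 ≤ T ≤ 100` (the `T₂ ≤ T₁` of §6.6);
* the bootstrap bounds (6.92)–(6.95) of §6.5 on `[0, T]`, as the landed predicate `GoodAt`
  (`TaoCascadeRescaledBootstrap.lean`, whose `T1`/`goodAt_of_mem_T1` discharge them);
* `PrimaryModes` = Lemma 6.9 at the scales `k = -1, 0` on `[0, T]` (implied constant `C₅`);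
* `SmallModes` = the bounds (6.116)–(6.117) of Prop. 6.13 on `b₁, c₁` on `[0, T]` (implied
  constant `C₄`; the factor `K^{-1/4}` of (6.117) is not needed in §6.7 and is dropped);
* `ExitTrichotomy` = Cor. 6.14 (6.126)–(6.128) at `T`; `NextState` = the state bounds
  (6.139)–(6.144) of the conclusion of Prop. 6.15 (its time constraint (6.138) is kept separate).

All of this is bundled as `ZeroScale.Context`. Proved here: constant-coefficient corollaries of
the landed comparison lemmas (`Literature/Analysis/ODE/LinearComparison.lean`,
`TaoCascadeZeroScale.lean`: `le_add_mul_of_deriv_le`, `sqrt_sq_add_sq_le_of_deriv`), the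
elementary consequences of the energy bounds (sizes of the modes at scales `-2, …, 2` on `[0, T]`,
via the landed API of `TaoCascadeRescaledEnergy.lean`), and the **reduced equations of motion
(6.129)–(6.133)** of §6.6 in the `Context` packaging (`Context.da_zero`, `db_zero`, `dc_zero`,
`dd_zero`, `da_one`; specialisations of the pointwise versions of `TaoCascadeFiveModes.lean`),
together with the energy inequality (6.49) at `k = 0, -1`.

## References

* T. Tao, J. Amer. Math. Soc. 29 (2016), 601–674 = arXiv:1402.0290v3, §6.5 (6.92)–(6.95),
  Lemma 6.9, §6.6 Prop. 6.13 (6.116)–(6.117), Cor. 6.14 (6.126)–(6.128), (6.129)–(6.133),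
  Prop. 6.15 (6.138)–(6.144), §6.7. [`Tao2016AveragedNS`]
-/

noncomputable section

open Set MeasureTheory intervalIntegral

namespace Literature.Analysis.FluidPDE

namespace TaoCascade

namespace ZeroScale

/-! ## Generic tools: constant-coefficient corollaries of the landed comparison lemmas -/

section Tools

/-- If `g' ≤ M` on `[a, b)` then `g(x) ≤ g(a) + M (x - a)` on `[a, b]` (the constant case of
`ODE.le_add_integral_of_deriv_right_le`). [folklore] -/
theorem le_add_mul_of_deriv_le {g g' : ℝ → ℝ} {a b M : ℝ} (hg : ContinuousOn g (Icc a b))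
    (hg' : ∀ x ∈ Ico a b, HasDerivWithinAt g (g' x) (Ici x) x) (bound : ∀ x ∈ Ico a b, g' x ≤ M)
    {x : ℝ} (hx : x ∈ Icc a b) : g x ≤ g a + M * (x - a) := by
  have h := ODE.le_add_integral_of_deriv_right_le (A := fun _ => M) hg hg' continuousOn_const
    bound hx
  simpa [mul_comm] using h

/-- If `M ≤ g'` on `[a, b)` then `g(a) + M (x - a) ≤ g(x)` on `[a, b]` (the constant case of
`ODE.add_integral_le_of_le_deriv_right`). [folklore] -/
theorem add_mul_le_of_le_deriv {g g' : ℝ → ℝ} {a b M : ℝ} (hg : ContinuousOn g (Icc a b))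
    (hg' : ∀ x ∈ Ico a b, HasDerivWithinAt g (g' x) (Ici x) x) (bound : ∀ x ∈ Ico a b, M ≤ g' x)
    {x : ℝ} (hx : x ∈ Icc a b) : g a + M * (x - a) ≤ g x := by
  have h := ODE.add_integral_le_of_le_deriv_right (A := fun _ => M) hg hg' continuousOn_const
    bound hx
  simpa [mul_comm] using h

/-- If `|g'| ≤ M` on `[a, b)` then `|g(x) - g(a)| ≤ M (x - a)` on `[a, b]` (Mathlib's
`norm_image_sub_le_of_norm_deriv_right_le_segment`). [folklore] -/
theorem abs_sub_le_mul_of_abs_deriv_le {g g' : ℝ → ℝ} {a b M : ℝ}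
    (hg : ContinuousOn g (Icc a b)) (hg' : ∀ x ∈ Ico a b, HasDerivWithinAt g (g' x) (Ici x) x)
    (bound : ∀ x ∈ Ico a b, |g' x| ≤ M) {x : ℝ} (hx : x ∈ Icc a b) :
    |g x - g a| ≤ M * (x - a) := by
  have := norm_image_sub_le_of_norm_deriv_right_le_segment hg hg'
    (fun y hy => by simpa [Real.norm_eq_abs] using bound y hy) x hx
  simpa [Real.norm_eq_abs] using this

/-- **Growth of `√(u² + v²)` from a bound on `u u' + v v'`** (the constant case of
`TaoCascade.sqrt_le_of_deriv_right_le`, "`∂ₜ√W` in a weak sense"): if `u, v` are continuous on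
`[a, b]` with right derivatives `u', v'` on `[a, b)` and
`u u' + v v' ≤ M √(u² + v²) + L (u² + v²)` there (`M, L ≥ 0`), then for `x ∈ [a, b]`,
`√(u² + v²)(x) ≤ e^{L (x - a)} (√(u² + v²)(a) + M (x - a))`. [folklore] -/
theorem sqrt_sq_add_sq_le_of_deriv {u v u' v' : ℝ → ℝ} {a b M L : ℝ}
    (hu : ContinuousOn u (Icc a b)) (hv : ContinuousOn v (Icc a b))
    (hu' : ∀ x ∈ Ico a b, HasDerivWithinAt u (u' x) (Ici x) x)
    (hv' : ∀ x ∈ Ico a b, HasDerivWithinAt v (v' x) (Ici x) x) (hM : 0 ≤ M) (hL : 0 ≤ L)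
    (bound : ∀ x ∈ Ico a b,
      u x * u' x + v x * v' x ≤ M * Real.sqrt (u x ^ 2 + v x ^ 2) + L * (u x ^ 2 + v x ^ 2))
    {x : ℝ} (hx : x ∈ Icc a b) :
    Real.sqrt (u x ^ 2 + v x ^ 2) ≤
      Real.exp (L * (x - a)) * (Real.sqrt (u a ^ 2 + v a ^ 2) + M * (x - a)) := by
  have hW : ContinuousOn (fun y => u y ^ 2 + v y ^ 2) (Icc a b) := (hu.pow 2).add (hv.pow 2)
  have hW' : ∀ y ∈ Ico a b, HasDerivWithinAt (fun y => u y ^ 2 + v y ^ 2)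
      (2 * u y * u' y + 2 * v y * v' y) (Ici y) y :=
    fun y hy => (((hu' y hy).pow 2).add ((hv' y hy).pow 2)).congr_deriv (by norm_num)
  have h := sqrt_le_of_deriv_right_le (α := fun _ => M) hW hW' (fun y _ => by positivity)
    continuousOn_const (fun _ _ => hM) hL (fun y hy => by nlinarith [bound y hy]) hx
  simpa [mul_comm] using h

end Tools

/-! ## The standing hypotheses of §6.7 beyond Prop. 6.5 (i)–(ix) -/

/-- **Lemma 6.9 (almost all energy in primary modes) at the scales `k = -1, 0`** on `[0, T]`:
`Ẽ_k(t) ≤ ½(a_k² + b_k² + c_k² + d_k²)(t) + C₅ (1+ε₀)^{-n₀/2}` (the lower bound is (6.51); the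
implied constant `C₅` of the printed `O((1+ε₀)^{-n₀/2})` is explicit).
[cite: Tao2016AveragedNS, §6.5 Lemma 6.9] -/
structure PrimaryModes (ε₀ C₅ : ℝ) (n₀ : ℤ) (Y : Fin 4 → ℤ → ℝ → ℝ) (F : ℤ → ℝ → ℝ) (T : ℝ) :
    Prop where
  /-- Lemma 6.9 for `k = -1`. -/
  negOne : ∀ t ∈ Icc 0 T,
    F (-1) t ≤ (1 / 2) * ∑ i, Y i (-1) t ^ 2 + C₅ * (1 + ε₀) ^ (-(n₀ : ℝ) / 2)
  /-- Lemma 6.9 for `k = 0`. -/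
  zero : ∀ t ∈ Icc 0 T, F 0 t ≤ (1 / 2) * ∑ i, Y i 0 t ^ 2 + C₅ * (1 + ε₀) ^ (-(n₀ : ℝ) / 2)

/-- **The bounds (6.117) of Prop. 6.13 on `b₁, c₁`** on `[0, T]` (in the source `T = T₂`, with
`∫₀^{T₂} a₁² ≤ K^{-1/4}`): `|b₁(t)| ≤ C₄ K^{-1/4} ε` and `|c₁(t)| ≤ C₄ exp(-K¹⁰/2) ε²` (the printed
bound carries an extra `K^{-1/4}`, not needed in §6.7), implied constant `C₄` explicit.
[cite: Tao2016AveragedNS, §6.6 Prop. 6.13 (6.117)] -/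
structure SmallModes (K ε C₄ : ℝ) (Y : Fin 4 → ℤ → ℝ → ℝ) (T : ℝ) : Prop where
  /-- (6.117), first bound. -/
  b_one : ∀ t ∈ Icc 0 T, |Y 1 1 t| ≤ C₄ * K ^ (-(1 : ℝ) / 4) * ε
  /-- (6.117), second bound (weakened by the factor `K^{-1/4} ≤ 1`). -/
  c_one : ∀ t ∈ Icc 0 T, |Y 2 1 t| ≤ C₄ * Real.exp (-K ^ 10 / 2) * ε ^ 2

/-- **Cor. 6.14 (exit trichotomy, again)** for the time `T = T₂` of §6.6: backwards flow of
energy `Ẽ_{-1}(T₂) = K⁻¹⁰ (1+ε₀)^{2/10}` (6.126), or forwards flow `∫₀^{T₂} a₁² = K^{-1/4}`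
(6.127), or running out the clock `T₂ = 100` (6.128). [cite: Tao2016AveragedNS, §6.6 Cor. 6.14] -/
def ExitTrichotomy (ε₀ K : ℝ) (Y : Fin 4 → ℤ → ℝ → ℝ) (F : ℤ → ℝ → ℝ) (T : ℝ) : Prop :=
  F (-1) T = (K ^ 10)⁻¹ * (1 + ε₀) ^ ((2 : ℝ) / 10) ∨
    ∫ t in (0 : ℝ)..T, Y 0 1 t ^ 2 = K ^ (-(1 : ℝ) / 4) ∨ T = 100

/-- **The state bounds (6.139)–(6.144) in the conclusion of Prop. 6.15 (reduced induction claim,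
II)** at a time `τ₁`: `(1+ε₀)^{-1/100} ≤ a₁(τ₁) ≤ (1+ε₀)^{1/100}`,
`2·10⁻⁵ ε ≤ b₀(τ₁) ≤ ½ 10⁵ ε`, `2 exp(K⁹) ε² ≤ c₀(τ₁) ≤ ½ exp(K¹⁰) ε²`, `Ẽ₀(τ₁) ≤ ½ K⁻²⁰`.
This structure deliberately omits the first display (6.138) `1/100 ≤ τ₁ ≤ T₂` of the
proposition, which the assembly theorem states separately (Prop. 6.15 is
"`∃ τ₁ ∈ [1/100, T₂], NextState … τ₁`", not "`∃ τ₁, NextState … τ₁`").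
[cite: Tao2016AveragedNS, §6.6 Prop. 6.15 (6.139)–(6.144)] -/
structure NextState (ε₀ K ε : ℝ) (Y : Fin 4 → ℤ → ℝ → ℝ) (F : ℤ → ℝ → ℝ) (τ₁ : ℝ) : Prop where
  /-- (6.139), lower. -/
  a_one_ge : (1 + ε₀) ^ (-(1 : ℝ) / 100) ≤ Y 0 1 τ₁
  /-- (6.139), upper. -/
  a_one_le : Y 0 1 τ₁ ≤ (1 + ε₀) ^ ((1 : ℝ) / 100)
  /-- (6.140). -/
  b_zero_ge : 2 / 10 ^ 5 * ε ≤ Y 1 0 τ₁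
  /-- (6.141). -/
  b_zero_le : Y 1 0 τ₁ ≤ 10 ^ 5 / 2 * ε
  /-- (6.142). -/
  c_zero_ge : 2 * Real.exp (K ^ 9) * ε ^ 2 ≤ Y 2 0 τ₁
  /-- (6.143). -/
  c_zero_le : Y 2 0 τ₁ ≤ Real.exp (K ^ 10) / 2 * ε ^ 2
  /-- (6.144). -/
  energy_le : F 0 τ₁ ≤ 1 / 2 * (K ^ 20)⁻¹

/-- The standing hypotheses of §6.7 bundled: the parameter signs, Prop. 6.5 (i)–(ix) with the
corrected `c`-coefficient, a time `0 ≤ T ≤ 100` (the `T₂` of §6.6) and, on `[0, T]`, the bootstrap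
bounds (6.92)–(6.95), Lemma 6.9 at scales `-1, 0` and the bounds (6.117) of Prop. 6.13.
[cite: Tao2016AveragedNS, §6.7] -/
structure Context (ε₀ K ε C₁ C₂ C₃ C₄ C₅ : ℝ) (n₀ N : ℤ) (τ : ℤ → ℝ) (Y : Fin 4 → ℤ → ℝ → ℝ)
    (F : ℤ → ℝ → ℝ) (T : ℝ) : Prop where
  ε₀_pos : 0 < ε₀
  ε₀_lt : ε₀ < 1
  K_ge : 2 ≤ K
  ε_pos : 0 < ε
  ε_le : ε ≤ 1
  C₁_nn : 0 ≤ C₁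
  C₂_nn : 0 ≤ C₂
  C₃_nn : 0 ≤ C₃
  C₄_nn : 0 ≤ C₄
  C₅_nn : 0 ≤ C₅
  le_N : n₀ ≤ N
  hyp : RescaledHypotheses (1 / 10 ^ 5 * Real.exp (-K ^ 10 / 2)) ε₀ K ε C₁ C₂ C₃ n₀ N τ Y F
  T_nn : 0 ≤ T
  T_le : T ≤ 100
  /-- The bootstrap bounds (6.92)–(6.95) of §6.5 (`GoodAt`) on `[0, T]`. -/
  loc : ∀ t ∈ Icc 0 T, GoodAt ε₀ K Y F t
  prim : PrimaryModes ε₀ C₅ n₀ Y F T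
  small : SmallModes K ε C₄ Y T

/-! ## Derivatives of the modes -/

/-- The one-sided derivative `∂_t Y_{i,k}` within `[τ₀, +∞)`. [folklore] -/
def dY (τ₀ : ℝ) (Y : Fin 4 → ℤ → ℝ → ℝ) (i : Fin 4) (k : ℤ) : ℝ → ℝ :=
  derivWithin (Y i k) (Ici τ₀)

/-- The one-sided derivative `∂_t Ẽ_k` within `[τ₀, +∞)`. [folklore] -/
def dF (τ₀ : ℝ) (F : ℤ → ℝ → ℝ) (k : ℤ) : ℝ → ℝ :=
  derivWithin (F k) (Ici τ₀)

section Basic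

variable {ε₀ K ε C₁ C₂ C₃ C₄ C₅ : ℝ} {n₀ N : ℤ} {τ : ℤ → ℝ} {Y : Fin 4 → ℤ → ℝ → ℝ}
  {F : ℤ → ℝ → ℝ} {T : ℝ}

/-- The initial rescaled time is `≤ 0`. [cite: Tao2016AveragedNS, §6.7] -/
theorem Context.τ₀_le (cx : Context ε₀ K ε C₁ C₂ C₃ C₄ C₅ n₀ N τ Y F T) : τ (n₀ - N) ≤ 0 :=
  cx.hyp.tau_le _ le_rfl (by linarith [cx.le_N])

/-- `0 < 1 + ε₀`. [folklore] -/
theorem Context.q_pos (cx : Context ε₀ K ε C₁ C₂ C₃ C₄ C₅ n₀ N τ Y F T) : 0 < 1 + ε₀ := by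
  linarith [cx.ε₀_pos]

/-- `1 < 1 + ε₀`. [folklore] -/
theorem Context.one_lt_q (cx : Context ε₀ K ε C₁ C₂ C₃ C₄ C₅ n₀ N τ Y F T) : 1 < 1 + ε₀ := by
  linarith [cx.ε₀_pos]

/-- `1 + ε₀ < 2`. [folklore] -/
theorem Context.q_lt_two (cx : Context ε₀ K ε C₁ C₂ C₃ C₄ C₅ n₀ N τ Y F T) : 1 + ε₀ < 2 := by
  linarith [cx.ε₀_lt]

/-- `0 < K`. [folklore] -/
theorem Context.K_pos (cx : Context ε₀ K ε C₁ C₂ C₃ C₄ C₅ n₀ N τ Y F T) : 0 < K := by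
  linarith [cx.K_ge]

/-- `1 ≤ K`. [folklore] -/
theorem Context.one_le_K (cx : Context ε₀ K ε C₁ C₂ C₃ C₄ C₅ n₀ N τ Y F T) : 1 ≤ K := by
  linarith [cx.K_ge]

/-- `K⁻ⁿ ≤ 1/2` for `n ≥ 1`. [folklore] -/
theorem Context.inv_K_pow_le_half (cx : Context ε₀ K ε C₁ C₂ C₃ C₄ C₅ n₀ N τ Y F T) {n : ℕ}
    (hn : 1 ≤ n) : (K ^ n)⁻¹ ≤ 1 / 2 := by
  have h2 : (2 : ℝ) ≤ K ^ n := by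
    calc (2 : ℝ) = 2 ^ 1 := by norm_num
      _ ≤ 2 ^ n := pow_le_pow_right₀ (by norm_num) hn
      _ ≤ K ^ n := pow_le_pow_left₀ (by norm_num) cx.K_ge n
  rw [one_div]
  exact inv_anti₀ (by norm_num) h2

/-- `(1+ε₀)^x ≤ 2^x` for `x ≥ 0`. [folklore] -/
theorem Context.q_rpow_le (cx : Context ε₀ K ε C₁ C₂ C₃ C₄ C₅ n₀ N τ Y F T) {x : ℝ}
    (hx : 0 ≤ x) : (1 + ε₀) ^ x ≤ (2 : ℝ) ^ x :=
  Real.rpow_le_rpow cx.q_pos.le cx.q_lt_two.le hx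

/-- `(1+ε₀)^x ≤ 1` for `x ≤ 0`. [folklore] -/
theorem Context.q_rpow_le_one (cx : Context ε₀ K ε C₁ C₂ C₃ C₄ C₅ n₀ N τ Y F T) {x : ℝ}
    (hx : x ≤ 0) : (1 + ε₀) ^ x ≤ 1 :=
  Real.rpow_le_one_of_one_le_of_nonpos cx.one_lt_q.le hx

/-- `1 ≤ (1+ε₀)^x` for `0 ≤ x`. [folklore] -/
theorem Context.one_le_q_rpow (cx : Context ε₀ K ε C₁ C₂ C₃ C₄ C₅ n₀ N τ Y F T) {x : ℝ}
    (hx : 0 ≤ x) : 1 ≤ (1 + ε₀) ^ x :=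
  Real.one_le_rpow cx.one_lt_q.le hx

/-- Right derivative of a mode at `t ≥ τ₀`. [cite: Tao2016AveragedNS, §6.7] -/
theorem Context.hasDerivWithinAt_Y (cx : Context ε₀ K ε C₁ C₂ C₃ C₄ C₅ n₀ N τ Y F T) (i : Fin 4)
    (k : ℤ) {t : ℝ} (ht : τ (n₀ - N) ≤ t) :
    HasDerivWithinAt (Y i k) (dY (τ (n₀ - N)) Y i k t) (Ici t) t :=
  cx.hyp.hasDeriv_X i k ht

/-- Right derivative of an energy at `t ≥ τ₀`. [cite: Tao2016AveragedNS, §6.7] -/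
theorem Context.hasDerivWithinAt_F (cx : Context ε₀ K ε C₁ C₂ C₃ C₄ C₅ n₀ N τ Y F T) (k : ℤ)
    {t : ℝ} (ht : τ (n₀ - N) ≤ t) :
    HasDerivWithinAt (F k) (dF (τ (n₀ - N)) F k t) (Ici t) t :=
  cx.hyp.hasDeriv_E k ht

/-- The modes are continuous on every `[a, b]` with `τ₀ ≤ a`. [cite: Tao2016AveragedNS, §6.7] -/
theorem Context.continuousOn_Y (cx : Context ε₀ K ε C₁ C₂ C₃ C₄ C₅ n₀ N τ Y F T) (i : Fin 4)
    (k : ℤ) {a b : ℝ} (ha : τ (n₀ - N) ≤ a) : ContinuousOn (Y i k) (Icc a b) :=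
  cx.hyp.continuousOn_X i k ha

/-- The energies are continuous on every `[a, b]` with `τ₀ ≤ a`. [cite: Tao2016AveragedNS, §6.7] -/
theorem Context.continuousOn_F (cx : Context ε₀ K ε C₁ C₂ C₃ C₄ C₅ n₀ N τ Y F T) (k : ℤ)
    {a b : ℝ} (ha : τ (n₀ - N) ≤ a) : ContinuousOn (F k) (Icc a b) :=
  cx.hyp.continuousOn_E k ha

/-- The mode derivatives are continuous on every `[a, b]` with `τ₀ ≤ a`. [cite: Tao2016AveragedNS, §6.7] -/
theorem Context.continuousOn_dY (cx : Context ε₀ K ε C₁ C₂ C₃ C₄ C₅ n₀ N τ Y F T) (i : Fin 4)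
    (k : ℤ) {a b : ℝ} (ha : τ (n₀ - N) ≤ a) : ContinuousOn (dY (τ (n₀ - N)) Y i k) (Icc a b) :=
  ODE.continuousOn_derivWithin_Icc_of_contDiffOn (cx.hyp.contDiffOn_Y i k) ha

/-- The energy derivatives are continuous on every `[a, b]` with `τ₀ ≤ a`. [cite: Tao2016AveragedNS, §6.7] -/
theorem Context.continuousOn_dF (cx : Context ε₀ K ε C₁ C₂ C₃ C₄ C₅ n₀ N τ Y F T) (k : ℤ)
    {a b : ℝ} (ha : τ (n₀ - N) ≤ a) : ContinuousOn (dF (τ (n₀ - N)) F k) (Icc a b) :=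
  ODE.continuousOn_derivWithin_Icc_of_contDiffOn (cx.hyp.contDiffOn_F k) ha

/-! ## Mode bounds from the energy bounds -/

/-- `|Y_{i,k}(t)| ≤ √(2 Ẽ_k(t))` (landed `RescaledHypotheses.abs_le_sqrt_energy`).
[cite: Tao2016AveragedNS, §6.4 Prop. 6.5 (iv)] -/
theorem Context.abs_Y_le_sqrt (cx : Context ε₀ K ε C₁ C₂ C₃ C₄ C₅ n₀ N τ Y F T) (i : Fin 4)
    (k : ℤ) {t : ℝ} (ht : τ (n₀ - N) ≤ t) : |Y i k t| ≤ Real.sqrt (2 * F k t) :=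
  cx.hyp.abs_le_sqrt_energy i k ht

/-- `Y_{i,k}(t)² ≤ 2 Ẽ_k(t)` (landed `RescaledHypotheses.sq_le_two_mul_energy`).
[cite: Tao2016AveragedNS, §6.4 Prop. 6.5 (iv)] -/
theorem Context.sq_Y_le (cx : Context ε₀ K ε C₁ C₂ C₃ C₄ C₅ n₀ N τ Y F T) (i : Fin 4)
    (k : ℤ) {t : ℝ} (ht : τ (n₀ - N) ≤ t) : Y i k t ^ 2 ≤ 2 * F k t :=
  cx.hyp.sq_le_two_mul_energy i k ht

/-- On `[0, T]`: `Ẽ₀ ≤ 1`, `Ẽ₁ ≤ 1`. [cite: Tao2016AveragedNS, §6.7] -/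
theorem Context.F_zero_le_one (cx : Context ε₀ K ε C₁ C₂ C₃ C₄ C₅ n₀ N τ Y F T) {t : ℝ}
    (ht : t ∈ Icc 0 T) : F 0 t ≤ 1 := by
  have h := (cx.loc t ht).during
  have h1 := cx.hyp.nonneg_F 1 t (cx.τ₀_le.trans ht.1)
  linarith

/-- On `[0, T]`: `Ẽ₁ ≤ 1`. [cite: Tao2016AveragedNS, §6.7] -/
theorem Context.F_one_le_one (cx : Context ε₀ K ε C₁ C₂ C₃ C₄ C₅ n₀ N τ Y F T) {t : ℝ}
    (ht : t ∈ Icc 0 T) : F 1 t ≤ 1 := by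
  have h := (cx.loc t ht).during
  have h1 := cx.hyp.nonneg_F 0 t (cx.τ₀_le.trans ht.1)
  linarith

/-- On `[0, T]`: `Ẽ_{-1} ≤ 2 K⁻¹⁰`. [cite: Tao2016AveragedNS, §6.7] -/
theorem Context.F_negOne_le (cx : Context ε₀ K ε C₁ C₂ C₃ C₄ C₅ n₀ N τ Y F T) {t : ℝ}
    (ht : t ∈ Icc 0 T) : F (-1) t ≤ 2 * (K ^ 10)⁻¹ := by
  have h := (cx.loc t ht).before 2 le_rfl
  have h2 : (1 + ε₀) ^ (((2 : ℕ) : ℝ) / 10) ≤ 2 := by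
    calc (1 + ε₀) ^ (((2 : ℕ) : ℝ) / 10) ≤ (2 : ℝ) ^ (((2 : ℕ) : ℝ) / 10) :=
          cx.q_rpow_le (by norm_num)
      _ ≤ (2 : ℝ) ^ (1 : ℝ) := Real.rpow_le_rpow_of_exponent_le (by norm_num) (by norm_num)
      _ = 2 := Real.rpow_one 2
  have hK : 0 ≤ (K ^ 10)⁻¹ := by have := cx.K_pos; positivity
  have : (1 : ℤ) - ((2 : ℕ) : ℤ) = -1 := by norm_num
  rw [this] at h
  calc F (-1) t ≤ (K ^ 10)⁻¹ * (1 + ε₀) ^ (((2 : ℕ) : ℝ) / 10) := h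
    _ ≤ (K ^ 10)⁻¹ * 2 := by gcongr
    _ = 2 * (K ^ 10)⁻¹ := by ring

/-- On `[0, T]`: `Ẽ_{-2} ≤ 2 K⁻¹⁰`. [cite: Tao2016AveragedNS, §6.7] -/
theorem Context.F_negTwo_le (cx : Context ε₀ K ε C₁ C₂ C₃ C₄ C₅ n₀ N τ Y F T) {t : ℝ}
    (ht : t ∈ Icc 0 T) : F (-2) t ≤ 2 * (K ^ 10)⁻¹ := by
  have h := (cx.loc t ht).before 3 (by norm_num)
  have h2 : (1 + ε₀) ^ (((3 : ℕ) : ℝ) / 10) ≤ 2 := by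
    calc (1 + ε₀) ^ (((3 : ℕ) : ℝ) / 10) ≤ (2 : ℝ) ^ (((3 : ℕ) : ℝ) / 10) :=
          cx.q_rpow_le (by norm_num)
      _ ≤ (2 : ℝ) ^ (1 : ℝ) := Real.rpow_le_rpow_of_exponent_le (by norm_num) (by norm_num)
      _ = 2 := Real.rpow_one 2
  have hK : 0 ≤ (K ^ 10)⁻¹ := by have := cx.K_pos; positivity
  have : (1 : ℤ) - ((3 : ℕ) : ℤ) = -2 := by norm_num
  rw [this] at h
  calc F (-2) t ≤ (K ^ 10)⁻¹ * (1 + ε₀) ^ (((3 : ℕ) : ℝ) / 10) := h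
    _ ≤ (K ^ 10)⁻¹ * 2 := by gcongr
    _ = 2 * (K ^ 10)⁻¹ := by ring

/-- On `[0, T]`: `Ẽ₂ ≤ K⁻³⁰`. [cite: Tao2016AveragedNS, §6.7] -/
theorem Context.F_two_le (cx : Context ε₀ K ε C₁ C₂ C₃ C₄ C₅ n₀ N τ Y F T) {t : ℝ}
    (ht : t ∈ Icc 0 T) : F 2 t ≤ (K ^ 30)⁻¹ := by
  have h := (cx.loc t ht).after 1 le_rfl
  have h2 : (1 + ε₀) ^ (-(10 : ℝ) * ((1 : ℕ) : ℝ)) ≤ 1 := cx.q_rpow_le_one (by norm_num)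
  have hK : 0 ≤ (K ^ 30)⁻¹ := by have := cx.K_pos; positivity
  have : (1 : ℤ) + ((1 : ℕ) : ℤ) = 2 := by norm_num
  rw [this] at h
  calc F 2 t ≤ (K ^ 30)⁻¹ * (1 + ε₀) ^ (-(10 : ℝ) * ((1 : ℕ) : ℝ)) := h
    _ ≤ (K ^ 30)⁻¹ * 1 := by gcongr
    _ = (K ^ 30)⁻¹ := by ring

/-- On `[0, T]`: the scale-`0` and scale-`1` modes are bounded by `√2 ≤ 3/2`. [cite: Tao2016AveragedNS, §6.7] -/
theorem Context.abs_Y_zero_le (cx : Context ε₀ K ε C₁ C₂ C₃ C₄ C₅ n₀ N τ Y F T) (i : Fin 4)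
    {t : ℝ} (ht : t ∈ Icc 0 T) : |Y i 0 t| ≤ 3 / 2 := by
  have h := cx.sq_Y_le i 0 (cx.τ₀_le.trans ht.1)
  have hF := cx.F_zero_le_one ht
  rw [abs_le]; constructor <;> nlinarith

/-- On `[0, T]`: `|Y_{i,1}| ≤ 3/2`. [cite: Tao2016AveragedNS, §6.7] -/
theorem Context.abs_Y_one_le (cx : Context ε₀ K ε C₁ C₂ C₃ C₄ C₅ n₀ N τ Y F T) (i : Fin 4)
    {t : ℝ} (ht : t ∈ Icc 0 T) : |Y i 1 t| ≤ 3 / 2 := by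
  have h := cx.sq_Y_le i 1 (cx.τ₀_le.trans ht.1)
  have hF := cx.F_one_le_one ht
  rw [abs_le]; constructor <;> nlinarith

/-- On `[0, T]`: `Y_{i,0}² ≤ 2`, `Y_{i,1}² ≤ 2`. [cite: Tao2016AveragedNS, §6.7] -/
theorem Context.sq_Y_zero_le (cx : Context ε₀ K ε C₁ C₂ C₃ C₄ C₅ n₀ N τ Y F T) (i : Fin 4)
    {t : ℝ} (ht : t ∈ Icc 0 T) : Y i 0 t ^ 2 ≤ 2 := by
  have h := cx.sq_Y_le i 0 (cx.τ₀_le.trans ht.1)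
  have hF := cx.F_zero_le_one ht
  linarith

/-- On `[0, T]`: `Y_{i,1}² ≤ 2`. [cite: Tao2016AveragedNS, §6.7] -/
theorem Context.sq_Y_one_le (cx : Context ε₀ K ε C₁ C₂ C₃ C₄ C₅ n₀ N τ Y F T) (i : Fin 4)
    {t : ℝ} (ht : t ∈ Icc 0 T) : Y i 1 t ^ 2 ≤ 2 := by
  have h := cx.sq_Y_le i 1 (cx.τ₀_le.trans ht.1)
  have hF := cx.F_one_le_one ht
  linarith

/-- On `[0, T]`: `Y_{i,-1}² ≤ 4 K⁻¹⁰` and `Y_{i,-2}² ≤ 4 K⁻¹⁰`. [cite: Tao2016AveragedNS, §6.7] -/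
theorem Context.sq_Y_negOne_le (cx : Context ε₀ K ε C₁ C₂ C₃ C₄ C₅ n₀ N τ Y F T) (i : Fin 4)
    {t : ℝ} (ht : t ∈ Icc 0 T) : Y i (-1) t ^ 2 ≤ 4 * (K ^ 10)⁻¹ := by
  have h := cx.sq_Y_le i (-1) (cx.τ₀_le.trans ht.1)
  have hF := cx.F_negOne_le ht
  linarith

/-- On `[0, T]`: `Y_{i,-2}² ≤ 4 K⁻¹⁰`. [cite: Tao2016AveragedNS, §6.7] -/
theorem Context.sq_Y_negTwo_le (cx : Context ε₀ K ε C₁ C₂ C₃ C₄ C₅ n₀ N τ Y F T) (i : Fin 4)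
    {t : ℝ} (ht : t ∈ Icc 0 T) : Y i (-2) t ^ 2 ≤ 4 * (K ^ 10)⁻¹ := by
  have h := cx.sq_Y_le i (-2) (cx.τ₀_le.trans ht.1)
  have hF := cx.F_negTwo_le ht
  linarith

/-- On `[0, T]`: `|Y_{i,-1}| ≤ 2 K⁻⁵`, `|Y_{i,-2}| ≤ 2 K⁻⁵`, `|Y_{i,2}| ≤ 2 K⁻¹⁵`. [cite: Tao2016AveragedNS, §6.7] -/
theorem Context.abs_Y_negOne_le (cx : Context ε₀ K ε C₁ C₂ C₃ C₄ C₅ n₀ N τ Y F T) (i : Fin 4)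
    {t : ℝ} (ht : t ∈ Icc 0 T) : |Y i (-1) t| ≤ 2 * (K ^ 5)⁻¹ := by
  have h := cx.sq_Y_negOne_le i ht
  have hK := cx.K_pos
  have hK5 : 0 < (K ^ 5)⁻¹ := by positivity
  have : (K ^ 10)⁻¹ = (K ^ 5)⁻¹ ^ 2 := by rw [← inv_pow]; ring
  rw [this] at h
  rw [abs_le]; constructor <;> nlinarith

/-- On `[0, T]`: `|Y_{i,-2}| ≤ 2 K⁻⁵`. [cite: Tao2016AveragedNS, §6.7] -/
theorem Context.abs_Y_negTwo_le (cx : Context ε₀ K ε C₁ C₂ C₃ C₄ C₅ n₀ N τ Y F T) (i : Fin 4)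
    {t : ℝ} (ht : t ∈ Icc 0 T) : |Y i (-2) t| ≤ 2 * (K ^ 5)⁻¹ := by
  have h := cx.sq_Y_negTwo_le i ht
  have hK := cx.K_pos
  have hK5 : 0 < (K ^ 5)⁻¹ := by positivity
  have : (K ^ 10)⁻¹ = (K ^ 5)⁻¹ ^ 2 := by rw [← inv_pow]; ring
  rw [this] at h
  rw [abs_le]; constructor <;> nlinarith

/-- On `[0, T]`: `|Y_{i,2}| ≤ 2 K⁻¹⁵`. [cite: Tao2016AveragedNS, §6.7] -/
theorem Context.abs_Y_two_le (cx : Context ε₀ K ε C₁ C₂ C₃ C₄ C₅ n₀ N τ Y F T) (i : Fin 4)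
    {t : ℝ} (ht : t ∈ Icc 0 T) : |Y i 2 t| ≤ 2 * (K ^ 15)⁻¹ := by
  have h := cx.sq_Y_le i 2 (cx.τ₀_le.trans ht.1)
  have hF := cx.F_two_le ht
  have hK := cx.K_pos
  have hK5 : 0 < (K ^ 15)⁻¹ := by positivity
  have : (K ^ 30)⁻¹ = (K ^ 15)⁻¹ ^ 2 := by rw [← inv_pow]; ring
  rw [this] at hF
  rw [abs_le]; constructor <;> nlinarith

/-- `√(Ẽ₀) ≤ 1` and `√(Ẽ₁) ≤ 1` on `[0, T]`. [cite: Tao2016AveragedNS, §6.7] -/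
theorem Context.sqrt_F_zero_le (cx : Context ε₀ K ε C₁ C₂ C₃ C₄ C₅ n₀ N τ Y F T) {t : ℝ}
    (ht : t ∈ Icc 0 T) : Real.sqrt (F 0 t) ≤ 1 := by
  rw [show (1 : ℝ) = Real.sqrt 1 by simp]
  exact Real.sqrt_le_sqrt (cx.F_zero_le_one ht)

/-- On `[0, T]`: `√Ẽ₁ ≤ 1`. [cite: Tao2016AveragedNS, §6.7] -/
theorem Context.sqrt_F_one_le (cx : Context ε₀ K ε C₁ C₂ C₃ C₄ C₅ n₀ N τ Y F T) {t : ℝ}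
    (ht : t ∈ Icc 0 T) : Real.sqrt (F 1 t) ≤ 1 := by
  rw [show (1 : ℝ) = Real.sqrt 1 by simp]
  exact Real.sqrt_le_sqrt (cx.F_one_le_one ht)

/-- On `[0, T]`: `√Ẽ₋₁ ≤ 1`. [cite: Tao2016AveragedNS, §6.7] -/
theorem Context.sqrt_F_negOne_le (cx : Context ε₀ K ε C₁ C₂ C₃ C₄ C₅ n₀ N τ Y F T) {t : ℝ}
    (ht : t ∈ Icc 0 T) : Real.sqrt (F (-1) t) ≤ 1 := by
  rw [show (1 : ℝ) = Real.sqrt 1 by simp]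
  apply Real.sqrt_le_sqrt
  have := cx.F_negOne_le ht
  have hK : (K ^ 10)⁻¹ ≤ 1 / 2 := cx.inv_K_pow_le_half (by norm_num)
  linarith

/-! ## The reduced equations of motion (6.129)–(6.133) on `[0, T]` -/

/-- The two spellings of the exponent `-n₀/2` agree. [folklore] -/
theorem rpow_neg_half_eq (q : ℝ) (n₀ : ℤ) :
    q ^ (-((n₀ : ℝ) / 2)) = q ^ (-(n₀ : ℝ) / 2) := by
  congr 1; ring

/-- The viscosity error size `C₁ (1+ε₀)^{-n₀/2}` at scale `0`. [cite: Tao2016AveragedNS, §6.7] -/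
theorem Context.err_zero (cx : Context ε₀ K ε C₁ C₂ C₃ C₄ C₅ n₀ N τ Y F T) {t : ℝ}
    (ht : t ∈ Icc 0 T) :
    C₁ * (1 + ε₀) ^ ((2 : ℝ) * ((0 : ℤ) : ℝ) - n₀ / 2) * Real.sqrt (F 0 t) ≤
      C₁ * (1 + ε₀) ^ (-(n₀ : ℝ) / 2) := by
  have h1 : (1 + ε₀) ^ ((2 : ℝ) * ((0 : ℤ) : ℝ) - n₀ / 2) = (1 + ε₀) ^ (-(n₀ : ℝ) / 2) := by
    congr 1; push_cast; ring
  rw [h1]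
  have := cx.sqrt_F_zero_le ht
  have h0 : 0 ≤ C₁ * (1 + ε₀) ^ (-(n₀ : ℝ) / 2) := mul_nonneg cx.C₁_nn (Real.rpow_nonneg cx.q_pos.le _)
  calc C₁ * (1 + ε₀) ^ (-(n₀ : ℝ) / 2) * Real.sqrt (F 0 t) ≤ C₁ * (1 + ε₀) ^ (-(n₀ : ℝ) / 2) * 1 := by
        gcongr
    _ = _ := mul_one _

/-- **(6.129)**: `|∂ₜa₀ + ε⁻² c₀ d₀| ≤ 5ε + 2K Ẽ_{-1} + C₁ (1+ε₀)^{-n₀/2}` on `[0, T]` (the printed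
`O(K⁻⁹)`, with `Ẽ_{-1}` kept explicit for the later improvement (6.179)).
[cite: Tao2016AveragedNS, §6.6 (6.129)] -/
theorem Context.da_zero (cx : Context ε₀ K ε C₁ C₂ C₃ C₄ C₅ n₀ N τ Y F T) {t : ℝ}
    (ht : t ∈ Icc 0 T) :
    |dY (τ (n₀ - N)) Y 0 0 t + (ε ^ 2)⁻¹ * Y 2 0 t * Y 3 0 t| ≤
      5 * ε + 2 * K * F (-1) t + C₁ * (1 + ε₀) ^ (-(n₀ : ℝ) / 2) := by
  have h := cx.hyp.eq_a_zero cx.ε_pos.le cx.K_pos.le cx.C₁_nn (by linarith [cx.ε₀_pos])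
    (cx.τ₀_le.trans ht.1) (cx.F_zero_le_one ht) le_rfl
  rw [rpow_neg_half_eq] at h
  have hε := cx.ε_pos
  have hε1 := cx.ε_le
  have hexp : Real.exp (-K ^ 10) ≤ 1 := by
    rw [Real.exp_le_one_iff]; have := pow_nonneg cx.K_pos.le 10; linarith
  have : 2 * ε ^ 2 * Real.exp (-K ^ 10) ≤ 3 * ε := by nlinarith [Real.exp_pos (-K ^ 10)]
  exact h.trans (by linarith)

/-- **(6.130)**: `|∂ₜb₀ - (ε a₀² - ε⁻¹ K¹⁰ c₀²)| ≤ C₁ (1+ε₀)^{-n₀/2}` on `[0, T]`.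
[cite: Tao2016AveragedNS, §6.6 (6.130)] -/
theorem Context.db_zero (cx : Context ε₀ K ε C₁ C₂ C₃ C₄ C₅ n₀ N τ Y F T) {t : ℝ}
    (ht : t ∈ Icc 0 T) :
    |dY (τ (n₀ - N)) Y 1 0 t - (ε * Y 0 0 t ^ 2 - ε⁻¹ * K ^ 10 * Y 2 0 t ^ 2)| ≤
      C₁ * (1 + ε₀) ^ (-(n₀ : ℝ) / 2) := by
  have h := cx.hyp.eq_b_zero cx.C₁_nn (by linarith [cx.ε₀_pos]) (cx.τ₀_le.trans ht.1)
    (cx.F_zero_le_one ht)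
  rwa [rpow_neg_half_eq] at h

/-- **(6.131)**: `|∂ₜc₀ - (ε² e^{-K¹⁰} a₀² + ε⁻¹ K¹⁰ b₀ c₀)| ≤ C₁ (1+ε₀)^{-n₀/2}` on `[0, T]`.
[cite: Tao2016AveragedNS, §6.6 (6.131)] -/
theorem Context.dc_zero (cx : Context ε₀ K ε C₁ C₂ C₃ C₄ C₅ n₀ N τ Y F T) {t : ℝ}
    (ht : t ∈ Icc 0 T) :
    |dY (τ (n₀ - N)) Y 2 0 t -
        (ε ^ 2 * Real.exp (-K ^ 10) * Y 0 0 t ^ 2 + ε⁻¹ * K ^ 10 * Y 1 0 t * Y 2 0 t)| ≤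
      C₁ * (1 + ε₀) ^ (-(n₀ : ℝ) / 2) := by
  have h := cx.hyp.eq_c_zero cx.C₁_nn (by linarith [cx.ε₀_pos]) (cx.τ₀_le.trans ht.1)
    (cx.F_zero_le_one ht)
  rwa [rpow_neg_half_eq] at h

/-- **(6.132)**: `|∂ₜd₀ - (ε⁻² c₀ a₀ - (1+ε₀)^{5/2} K d₀ a₁)| ≤ C₁ (1+ε₀)^{-n₀/2}` on `[0, T]`.
[cite: Tao2016AveragedNS, §6.6 (6.132)] -/
theorem Context.dd_zero (cx : Context ε₀ K ε C₁ C₂ C₃ C₄ C₅ n₀ N τ Y F T) {t : ℝ}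
    (ht : t ∈ Icc 0 T) :
    |dY (τ (n₀ - N)) Y 3 0 t -
        ((ε ^ 2)⁻¹ * Y 2 0 t * Y 0 0 t - (1 + ε₀) ^ ((5 : ℝ) / 2) * K * Y 3 0 t * Y 0 1 t)| ≤
      C₁ * (1 + ε₀) ^ (-(n₀ : ℝ) / 2) := by
  have h := cx.hyp.eq_d_zero cx.C₁_nn (by linarith [cx.ε₀_pos]) (cx.τ₀_le.trans ht.1)
    (cx.F_zero_le_one ht)
  rwa [rpow_neg_half_eq] at h

/-- `(1+ε₀)^{5/2} ≤ 8`. [folklore] -/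
theorem Context.q52_le (cx : Context ε₀ K ε C₁ C₂ C₃ C₄ C₅ n₀ N τ Y F T) :
    (1 + ε₀) ^ ((5 : ℝ) / 2) ≤ 8 := by
  calc (1 + ε₀) ^ ((5 : ℝ) / 2) ≤ (2 : ℝ) ^ ((5 : ℝ) / 2) := cx.q_rpow_le (by norm_num)
    _ ≤ (2 : ℝ) ^ ((3 : ℕ) : ℝ) := Real.rpow_le_rpow_of_exponent_le (by norm_num) (by norm_num)
    _ = 8 := by rw [Real.rpow_natCast]; norm_num

/-- `1 ≤ (1+ε₀)^{5/2}`. [folklore] -/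
theorem Context.one_le_q52 (cx : Context ε₀ K ε C₁ C₂ C₃ C₄ C₅ n₀ N τ Y F T) :
    1 ≤ (1 + ε₀) ^ ((5 : ℝ) / 2) := cx.one_le_q_rpow (by norm_num)

/-- `1/8 ≤ (1+ε₀)^{-5/2} ≤ 1`. [folklore] -/
theorem Context.qm52_le (cx : Context ε₀ K ε C₁ C₂ C₃ C₄ C₅ n₀ N τ Y F T) :
    (1 + ε₀) ^ (-(5 : ℝ) / 2) ≤ 1 := cx.q_rpow_le_one (by norm_num)

/-- `1/8 ≤ (1+ε₀)^{-5/2}`. [folklore] -/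
theorem Context.qm52_ge (cx : Context ε₀ K ε C₁ C₂ C₃ C₄ C₅ n₀ N τ Y F T) :
    1 / 8 ≤ (1 + ε₀) ^ (-(5 : ℝ) / 2) := by
  rw [show -(5 : ℝ) / 2 = -((5 : ℝ) / 2) by ring, Real.rpow_neg cx.q_pos.le, one_div]
  exact inv_anti₀ (Real.rpow_pos_of_pos cx.q_pos _) cx.q52_le

/-- `K^{-1/4} ≤ 1`. [folklore] -/
theorem Context.K_rpow_neg_quarter_le (cx : Context ε₀ K ε C₁ C₂ C₃ C₄ C₅ n₀ N τ Y F T) :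
    K ^ (-(1 : ℝ) / 4) ≤ 1 :=
  Real.rpow_le_one_of_one_le_of_nonpos cx.one_le_K (by norm_num)

/-- **(6.133)**: `|∂ₜa₁ - (1+ε₀)^{5/2} K d₀²| ≤ 16 C₄ ε² |a₁| + 4 C₄ e^{-K¹⁰/2} K⁻¹⁰ + 4 C₁ (1+ε₀)^{-n₀/2}`
on `[0, T]` (the printed `O(K⁻¹|a₁|) + O(K⁻²⁰)`). [cite: Tao2016AveragedNS, §6.6 (6.133)] -/
theorem Context.da_one (cx : Context ε₀ K ε C₁ C₂ C₃ C₄ C₅ n₀ N τ Y F T) {t : ℝ}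
    (ht : t ∈ Icc 0 T) :
    |dY (τ (n₀ - N)) Y 0 1 t - (1 + ε₀) ^ ((5 : ℝ) / 2) * K * Y 3 0 t ^ 2| ≤
      16 * C₄ * ε ^ 2 * |Y 0 1 t| + 4 * C₄ * Real.exp (-K ^ 10 / 2) * (K ^ 10)⁻¹ +
        4 * C₁ * (1 + ε₀) ^ (-(n₀ : ℝ) / 2) := by
  have h := cx.hyp.eq_a_one cx.ε_pos cx.C₁_nn (by linarith [cx.ε₀_pos]) (cx.τ₀_le.trans ht.1)
    (cx.F_one_le_one ht) (cx.small.b_one t ht) (cx.small.c_one t ht) ((cx.loc t ht).d_le)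
  refine h.trans ?_
  have hq := cx.q52_le
  have hq0 : 0 ≤ (1 + ε₀) ^ ((5 : ℝ) / 2) := Real.rpow_nonneg cx.q_pos.le _
  have hε := cx.ε_pos
  have hε1 := cx.ε_le
  have hK := cx.K_pos
  have hC₄ := cx.C₄_nn
  have hC₁ := cx.C₁_nn
  have hKq := cx.K_rpow_neg_quarter_le
  have hKq0 : 0 ≤ K ^ (-(1 : ℝ) / 4) := Real.rpow_nonneg hK.le _
  have hexp1 : Real.exp (-K ^ 10) ≤ 1 := by
    rw [Real.exp_le_one_iff]; have := pow_nonneg hK.le 10; linarith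
  have hexp2 : Real.exp (-K ^ 10 / 2) ≤ 1 := by
    rw [Real.exp_le_one_iff]; have := pow_nonneg hK.le 10; linarith
  have he1 := Real.exp_pos (-K ^ 10)
  have he2 := Real.exp_pos (-K ^ 10 / 2)
  have hK10 : 0 < (K ^ 10)⁻¹ := by positivity
  have ha := abs_nonneg (Y 0 1 t)
  -- the `|a₁|` coefficient
  have h1 : (1 + ε₀) ^ ((5 : ℝ) / 2) *
      (ε * (C₄ * K ^ (-(1 : ℝ) / 4) * ε) + ε ^ 2 * Real.exp (-K ^ 10) *
        (C₄ * Real.exp (-K ^ 10 / 2) * ε ^ 2)) ≤ 16 * C₄ * ε ^ 2 := by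
    have e1 : ε * (C₄ * K ^ (-(1 : ℝ) / 4) * ε) ≤ C₄ * ε ^ 2 := by
      calc ε * (C₄ * K ^ (-(1 : ℝ) / 4) * ε) = C₄ * ε ^ 2 * K ^ (-(1 : ℝ) / 4) := by ring
        _ ≤ C₄ * ε ^ 2 * 1 := by gcongr
        _ = _ := mul_one _
    have e2 : ε ^ 2 * Real.exp (-K ^ 10) * (C₄ * Real.exp (-K ^ 10 / 2) * ε ^ 2) ≤ C₄ * ε ^ 2 := by
      calc ε ^ 2 * Real.exp (-K ^ 10) * (C₄ * Real.exp (-K ^ 10 / 2) * ε ^ 2)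
          = C₄ * ε ^ 2 * (Real.exp (-K ^ 10) * Real.exp (-K ^ 10 / 2) * ε ^ 2) := by ring
        _ ≤ C₄ * ε ^ 2 * (1 * 1 * 1 ^ 2) := by gcongr
        _ = _ := by ring
    calc (1 + ε₀) ^ ((5 : ℝ) / 2) * (ε * (C₄ * K ^ (-(1 : ℝ) / 4) * ε) +
          ε ^ 2 * Real.exp (-K ^ 10) * (C₄ * Real.exp (-K ^ 10 / 2) * ε ^ 2))
        ≤ 8 * (C₄ * ε ^ 2 + C₄ * ε ^ 2) :=
          mul_le_mul hq (add_le_add e1 e2) (by positivity) (by norm_num)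
      _ = 16 * C₄ * ε ^ 2 := by ring
  -- the constant term
  have h2 : (1 + ε₀) ^ ((5 : ℝ) / 2) * (ε ^ 2)⁻¹ * (C₄ * Real.exp (-K ^ 10 / 2) * ε ^ 2) *
      (1 / 2 * (K ^ 10)⁻¹) ≤ 4 * C₄ * Real.exp (-K ^ 10 / 2) * (K ^ 10)⁻¹ := by
    have : (1 + ε₀) ^ ((5 : ℝ) / 2) * (ε ^ 2)⁻¹ * (C₄ * Real.exp (-K ^ 10 / 2) * ε ^ 2) *
        (1 / 2 * (K ^ 10)⁻¹) =
        (1 + ε₀) ^ ((5 : ℝ) / 2) * (1 / 2) * (C₄ * Real.exp (-K ^ 10 / 2) * (K ^ 10)⁻¹) := by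
      field_simp
    rw [this]
    calc (1 + ε₀) ^ ((5 : ℝ) / 2) * (1 / 2) * (C₄ * Real.exp (-K ^ 10 / 2) * (K ^ 10)⁻¹)
        ≤ 8 * (1 / 2) * (C₄ * Real.exp (-K ^ 10 / 2) * (K ^ 10)⁻¹) := by gcongr
      _ = _ := by ring
  have h3 : C₁ * (1 + ε₀) ^ (2 - (n₀ : ℝ) / 2) ≤ 4 * C₁ * (1 + ε₀) ^ (-(n₀ : ℝ) / 2) := by
    have e : (1 + ε₀) ^ (2 - (n₀ : ℝ) / 2) = (1 + ε₀) ^ (2 : ℝ) * (1 + ε₀) ^ (-(n₀ : ℝ) / 2) := by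
      rw [← Real.rpow_add cx.q_pos]; congr 1; ring
    have h4 : (1 + ε₀) ^ (2 : ℝ) ≤ 4 := by
      rw [show (2 : ℝ) = ((2 : ℕ) : ℝ) by norm_num, Real.rpow_natCast]
      nlinarith [cx.q_lt_two, cx.q_pos]
    have h0 : 0 ≤ (1 + ε₀) ^ (-(n₀ : ℝ) / 2) := Real.rpow_nonneg cx.q_pos.le _
    rw [e]
    calc C₁ * ((1 + ε₀) ^ (2 : ℝ) * (1 + ε₀) ^ (-(n₀ : ℝ) / 2))
        ≤ C₁ * (4 * (1 + ε₀) ^ (-(n₀ : ℝ) / 2)) := by gcongr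
      _ = _ := by ring
  nlinarith [mul_le_mul_of_nonneg_right h1 ha]

/-- **(6.49) at `k = 0`**: `∂ₜẼ₀ ≤ K (d₋₁² a₀ - (1+ε₀)^{5/2} d₀² a₁)`.
[cite: Tao2016AveragedNS, §6.4 (6.49)] -/
theorem Context.dF_zero (cx : Context ε₀ K ε C₁ C₂ C₃ C₄ C₅ n₀ N τ Y F T) {t : ℝ}
    (ht : τ (n₀ - N) ≤ t) :
    dF (τ (n₀ - N)) F 0 t ≤
      K * (Y 3 (-1) t ^ 2 * Y 0 0 t - (1 + ε₀) ^ ((5 : ℝ) / 2) * Y 3 0 t ^ 2 * Y 0 1 t) := by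
  have h := cx.hyp.energy 0 t ht
  simp only [Int.cast_zero, mul_zero, zero_div, Real.rpow_zero, mul_one, zero_sub,
    zero_add] at h
  exact h

/-- **(6.49) at `k = -1`**: `∂ₜẼ₋₁ ≤ K (1+ε₀)^{-5/2} (d₋₂² a₋₁ - (1+ε₀)^{5/2} d₋₁² a₀)`.
[cite: Tao2016AveragedNS, §6.4 (6.49)] -/
theorem Context.dF_negOne (cx : Context ε₀ K ε C₁ C₂ C₃ C₄ C₅ n₀ N τ Y F T) {t : ℝ}
    (ht : τ (n₀ - N) ≤ t) :
    dF (τ (n₀ - N)) F (-1) t ≤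
      K * (1 + ε₀) ^ (-(5 : ℝ) / 2) *
        (Y 3 (-2) t ^ 2 * Y 0 (-1) t - (1 + ε₀) ^ ((5 : ℝ) / 2) * Y 3 (-1) t ^ 2 * Y 0 0 t) := by
  have h := cx.hyp.energy (-1) t ht
  have e1 : (5 : ℝ) * ((-1 : ℤ) : ℝ) / 2 = -(5 : ℝ) / 2 := by push_cast; ring
  have e2 : (-1 : ℤ) - 1 = -2 := by norm_num
  have e3 : (-1 : ℤ) + 1 = 0 := by norm_num
  rw [e1, e2, e3] at h
  exact h

end Basic

end ZeroScale

end TaoCascade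

end Literature.Analysis.FluidPDE
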